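import Literature.MathematicalPhysics.QuantumFieldTheory.Balaban1983to89.B8Eq191FlatLettersCubeMember
import Literature.MathematicalPhysics.QuantumFieldTheory.Balaban1983to89.B4Block227

/-!
# `Balaban1983to89.B8Eq191FlatDirichletCoercive` — [Balaban1985RegularSpaces] (1.91) p. 91 AT `U₀ = 1` WITH DIRICHLET CONDITIONS: THE `k`-UNIFORM
# WEIGHTED LOWER BOUND of the flat multi-level form `Δ_{Ω₀} + Q′ᵀaQ′` on a finite region — [B6] (2.26)–(2.27) p. 235 block by block ([B4] (2.27) with the
# repaired constant `min{8, a}`), for the Dirichlet compression «`G(Ω) = (ΩΔ_aΩ)⁻¹`» of [B6] p. 228, on the explicit real kernel of `B8Eq191FlatDirichletForm`;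
# instance at the concrete cube member `{□_j}` of (1.131)

statement-level skeleton of published theorems with citation tags; proofs where landed; nothing here is a claim about the
Yang–Mills mass gap

T. Bałaban, *Spaces of regular gauge field configurations on a lattice and gauge fixing conditions*, Commun. Math. Phys. **99** (1985) 75–102
`[Balaban1985RegularSpaces]` ("B8"): (1.91) p. 91 («`G′ = (Δ + Q′*aQ′)⁻¹`»), (1.92) p. 91, (1.98) p. 92, (1.101) p. 93, (1.131) p. 99, (1.5)–(1.6) p. 77;
[4] = T. Bałaban, *Propagators for lattice gauge theories in a background field*, Commun. Math. Phys. **99** (1985) 389–434 `[Balaban1985BackgroundPropagators]`,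
(3.23)–(3.24) p. 394; [B6] = T. Bałaban, *Propagators and renormalization transformations for lattice gauge theories. II*, Commun. Math. Phys. **96** (1984)
223–250 `[Balaban1984PropagatorsII]`, p. 228 (verbatim, held text `paper:balaban1984-cmp96-propagators-rt-ii` p. 6): «We will consider operators with Dirichlet
boundary conditions on Ωᶜ … G(Ω) = (Δ_a↾Ω)⁻¹ = (ΩΔ_aΩ)⁻¹ … All the reasonings and the results of this paper hold, with minor and obvious changes, for the
operators G(Ω)», (2.26)–(2.27) p. 235; [B4] = T. Bałaban, *Regularity and decay of lattice Green's functions*, Commun. Math. Phys. **89** (1983) 571–597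
`[Balaban1983RegularityDecay]`, (2.27) p. 580 (block Poincaré + block mean; repaired constant `min{8,a}`, `B4Block227.block227_real`).

CITATION HEADER (lean-in-tree rule).  Cell `pub-ymgap` (YM Track A, HUMAN RULING D-0062), DAG node N05 = [B8], seat `pub-ymgap-dag-n05-c` (g8; R134 fan-out;
bus INBOX l.18891 INTENT-1, dag-lead DEDUP-276 GO, lit-balaban desk ME #24 «FREE for base n05-c» l.18955).  THE LINE: the flat road to Proposition 6 at the
concrete cube member `{□_j}` (`B8Prop6CubeMemberFlatScalar.prop6_cubeMember_flat_of_real`, seat n05-e g4) displays THREE REAL INEQUALITY FAMILIES on the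
explicit flat Dirichlet multi-level matrix `T = (K(x,z))_{x,z∈□₀}` — (1.101) for `T⁻¹`, (1.92) for `T⁻¹(T⁻¹Qᵀ)(QT⁻²Qᵀ)⁻¹`, (1.98) for `1 − T⁻¹Qᵀ(QT⁻²Qᵀ)⁻¹QT⁻¹` —
i.e. [4] Thms 3.1∕3.2 AT `U₀ = 1` WITH DIRICHLET CONDITIONS on `□₀ᶜ` (n05-e g4 HANDOFF «(R1′), XL, unowned»); the tree proves these displays at `U₀ = 1` on the
TORUS ∕ NEUMANN-BOX carriers only (`B8Ineq198MultiLevelBox`, `B8Ineq192MultiLevelBoxP23` on the `B6…MultiLevelBox` chain).  THIS FILE is brick 1 of the Dirichlet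
twin: the GLOBAL WEIGHTED LOWER BOUND of the form, uniform in the number of levels — the step every printed route to (1.101) starts from ([B6] §2: the local
inverses of the random-walk expansion; [B5] p. 36: the unperturbed form of the exponential conjugation).

WHAT THIS FILE PROVES (theorems only; 0 `def`; every input BY NAME: `B4Block227.block227_real`, `B8Eq191FlatDirichletForm.quadForm_lap_flat_eq`,
`QuantumLattice.blockMap_blockBase_add`, `B8Eq191FlatLettersCubeMember.towers_disjoint_cube`).  Kernel letter `K` with its defining equation `hK` exactly as in
`B8Eq191FlatDirichletForm.eq_zero_of_quadForm_flat_eq_zero` (data `η, L, m, Λs, a`; `S ⊂ ℤᵈ` finite; `v` supported in `S`).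
* §1–§2 THE CHART of a block `B(y)` of side `n + 1` in `ℤᵈ` (`t ↦ (n+1)·y + t`, `t ∈ {0,…,n}ᵈ`; onto, injective, `stepUp ↦ + e_μ`, exits the block exactly at
  `t_μ = n`), block sums and internal-bond sums as sums over offsets, and ★ `block227_zd` = [B4] (2.27) REPAIRED transported to the `ℤᵈ` block:
  `min{8,a′}·Σ_B F² ≤ (n+1)²·Σ_μ Σ_{x,x+e_μ∈B}(F_x − F_{x+e_μ})² + a′(n+1)^{−d}(Σ_B F)²`.
* §3 the pieces of the form: `sq_le_lapForm` (the Dirichlet-Laplacian part in direction `μ` dominates `Σ_{x∈S}(v_x − v_{x+e_μ})²` — boundary term dropped),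
  ★ `gramForm_eq_sum_sq` (the averaging part at one level IS `c·Σ_{y∈Λ}(Σ_{B(y)∩S} v)²`), `quadForm_flat_split` (form = `η⁻²Σ_μ` Laplacian part + `Σ_j` averaging part).
* §4 tower-block bookkeeping: `sum_towerSites_eq_sum_blocks`, ★ `sum_towerBlocks_le` (a site of `S` in at most one tower block ⇒ `Σ_{blocks} Σ_{block} g ≤ Σ_S g` for
  `g ≥ 0`).
* §5 ★ `towerBlock_weighted` (`block227_zd` × `(Lʲη)⁻²`: `min{8,a′_j}(Lʲη)⁻²Σ_B v² ≤ η⁻²Σ_μΣ_{int. bonds}(∇v)² + a_jL^{−2dj}(Σ_B v)²`, `a′_j = a_jη²L^{2j}L^{−dj}`) and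
  ★★ **`weighted_coercive_flatDirichlet`**: under «every tower block `B^j(y)`, `y ∈ Λ_j`, meeting `S` lies in `S`» and «a site of `S` lies in at most one tower
  block», `Σ_{j≤m} min{8, a′_j}·(Lʲη)⁻²·Σ_{x∈S : B^j(x)∈Λ_j} v(x)² ≤ Σ_{x,z∈S} v(x)K(x,z)v(z)`; ★ `weighted_coercive_flatDirichlet_uniform` (one constant `a₀ ≤ 8`
  below every `a′_j` — e.g. print's `a_j = a₀η⁻²L^{(d−2)j}` — gives `a₀·Σ_j(Lʲη)⁻²Σ_{tower j} v² ≤ form`, UNIFORM in `k, η, m, S, Λs`); `weighted_coercive_flatMatrix`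
  (the same for `⟨u, Tu⟩`, `T = (K(x,z))_{x,z∈S}` the matrix of `B8Eq191FlatDirichletForm.isUnit_flatMatrix`, `u : S → ℝ`).
* §6 THE CUBE MEMBER: `towerBlock_subset_cube` (`B^j(y) ⊂ □_j ⊂ □₀` for `y ∈ Λs_n(j)`), ★★ **`weighted_coercive_cubeMember`** — the bound for the letters
  `S = □₀`, `K` at `(η, L, n, cubeLamS, w)` of `prop6_cubeMember_flat_of_real`, geometric hypotheses DISCHARGED by `towerBlock_subset_cube` and n05-e's
  `towers_disjoint_cube`; no threshold, no largeness condition.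

HONEST SCOPE.  (i) A lower bound of a quadratic form (finite real linear algebra + [B4] (2.27) by name); it is NOT (1.101), NOT (1.92), NOT (1.98) — those need
DECAY of `T⁻¹` on top of this bound ([B6] §2 ∕ [B5] p. 36), not typed here.  (ii) In print Proposition 6 runs Theorem 4 on the whole torus with the level-0
region `Λ′₀ = T∖□₁` ([B8] p. 99; lit-balaban desk ME #24): the Dirichlet-on-`□₀ᶜ` matrix is the tree's CONSUMER-SIDE carrier (n05-e g3∕g4), licensed by [B6] p. 228's
sentence; this file serves that carrier and asserts nothing about print's torus reading.  (iii) Constants: `min{8, a′_j}` per level, `a′_j = a_jη²L^{2j}L^{−dj}`; the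
`8` is [B4]'s repaired block constant (`4s²sin²(π∕2s) ≥ 8`), not optimal.  Count-neutral; N05 NOT discharged; one finite `T⁴` programme at fixed `ε`, Bałaban as
printed; nothing continuum ∕ ℝ⁴ ∕ OS ∕ mass-gap ∕ Clay.  No `sorry`, no `def`, no `instance`, no `notation`.  Unit `pub-ymgap-dag-n05-c` (g8), 2026-08-27.

RELATED IN THE TREE, NOT DUPLICATED (searched 2026-08-27T10:40Z: `rg -l 'coerciv|block227|blockPoincare' Balaban1983to89/`): `B4Block227.block227_real` ∕
`blockForm_ineq` (the block inequality on `Fin D → Fin (n+1)`, USED), `Beta.CoordCubePoincare.blockPoincare_of_charts` (variance form over finite site types),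
`B4BoxCov237.lblock_poincare` ∕ `B4Lower18.rblock_poincare` ([B4] carriers on `Fin (d+1) → ℤ`), `B6GOmega.quadForm_compress_le/ge` (the p. 228 compression
principle over `B4.Idx` carriers), `B6Ineq261LevelGap` ∕ `B6MultiLevelBoxOperator` (p21's Neumann-box chain), `B9Eq323FlatBlockPoincare` (torus sites),
`T4ConstrainedAgmonD.block_poincare_4D`; none states the multi-level weighted bound on the `ℤᵈ`∕`blockMap`∕`Finset` carrier of `B8Eq191FlatDirichletForm`.
-/

noncomputable section

namespace Literature.MathematicalPhysics.QuantumFieldTheory.Balaban1983to89.B8Eq191FlatDirichletCoercive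

open Finset
open B7Prop1Explicit (e)
open Literature.MathematicalPhysics.QuantumLattice (blockMap blockBase blockMap_blockBase_add)
open Beta.CoordCubePoincare (stepUp)
open B4Block227 (block227_real)
open B8Eq191FlatDirichletForm (quadForm_lap_flat_eq)
open B8Eq131Cubes (cube mem_cube_iff)
open B8Eq131CubesAdmissible (cubeFam cubeFam_false_of_le)
open B8CubeMemberZd (cubeLamS inBox_sq_of_mem_cubeLamS)
open B8Eq191FlatLettersCubeMember (under_iff_blockMap_eq cubeFam_subset_zero towers_disjoint_cube)

variable {d : ℕ}

/-! ## §1 The chart `t ↦ (n+1)·y + t` of the block `B(y)` of side `n + 1` in `ℤᵈ` -/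

/-- The chart lands in the block: `B((n+1)y + t) = y` for offsets `t ∈ {0,…,n}ᵈ`. [folklore]
[cite: Balaban1984PropagatorsI, §1 (the blocks `B(y)`)] -/
theorem blockMap_chart (n : ℕ) (y : Fin d → ℤ) (t : Fin d → Fin (n + 1)) :
    blockMap (n + 1) (blockBase (n + 1) y + fun i => ((t i : ℕ) : ℤ)) = y :=
  blockMap_blockBase_add (n + 1) y (fun i => (t i : ℕ)) fun i => (t i).isLt

/-- The chart is injective. [folklore] [cite: Balaban1985RegularSpaces, p.79 (the blocks `Bʲ(y)`); Balaban1984PropagatorsI, §1] -/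
theorem chart_injective (n : ℕ) (y : Fin d → ℤ) :
    Function.Injective (fun t : Fin d → Fin (n + 1) => blockBase (n + 1) y + fun i => ((t i : ℕ) : ℤ)) := by
  intro t t' h
  funext i
  have hi := congrFun h i
  simp only [Pi.add_apply, add_right_inj] at hi
  exact Fin.ext (by exact_mod_cast hi)

/-- The chart is onto the block: every `x` with `B(x) = y` is `(n+1)y + t` for some offset `t`. [folklore]
[cite: Balaban1985RegularSpaces, p.79 (the blocks `Bʲ(y)`); Balaban1984PropagatorsI, §1] -/
theorem exists_chart_eq {n : ℕ} {y x : Fin d → ℤ} (hx : blockMap (n + 1) x = y) :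
    ∃ t : Fin d → Fin (n + 1), (blockBase (n + 1) y + fun i => ((t i : ℕ) : ℤ)) = x := by
  have hM : (0 : ℤ) < ((n + 1 : ℕ) : ℤ) := by exact_mod_cast Nat.succ_pos n
  have hlt : ∀ i, (x i % ((n + 1 : ℕ) : ℤ)).toNat < n + 1 := by
    intro i
    have h1 := Int.emod_lt_of_pos (x i) hM
    have h0 := Int.emod_nonneg (x i) hM.ne'
    omega
  refine ⟨fun i => ⟨(x i % ((n + 1 : ℕ) : ℤ)).toNat, hlt i⟩, ?_⟩
  subst hx
  funext i
  simp only [blockBase, blockMap, Pi.add_apply, Int.toNat_of_nonneg (Int.emod_nonneg (x i) hM.ne')]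
  exact Int.mul_ediv_add_emod (x i) _

/-- An in-block step: for an offset with `t_μ ≠ n`, `(n+1)y + (t + e_μ) = ((n+1)y + t) + e_μ`. [folklore]
[cite: Balaban1985RegularSpaces, p.79 (the blocks `Bʲ(y)`); Balaban1983RegularityDecay, (2.26) p.580 (bonds inside a block)] -/
theorem chart_stepUp (n : ℕ) (y : Fin d → ℤ) (t : Fin d → Fin (n + 1)) (μ : Fin d) (ht : t μ ≠ Fin.last n) :
    (blockBase (n + 1) y + fun i => ((stepUp t μ i : ℕ) : ℤ)) = (blockBase (n + 1) y + fun i => ((t i : ℕ) : ℤ)) + e μ := by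
  funext ν
  simp only [stepUp, e, Pi.add_apply]
  by_cases h : ν = μ
  · subst h
    rw [Function.update_self, Pi.single_eq_same, Fin.val_add_one_of_lt (Fin.lt_last_iff_ne_last.mpr ht)]
    push_cast; ring
  · rw [Function.update_of_ne h, Pi.single_eq_of_ne h]; ring

/-- Stepping out of the block: for an offset with `t_μ = n`, the `μ`-label of `((n+1)y + t) + e_μ` is `y_μ + 1`. [folklore]
[cite: Balaban1985RegularSpaces, p.79 (the blocks `Bʲ(y)`); Balaban1983RegularityDecay, (2.26) p.580] -/
theorem blockMap_chart_add_e_of_last (n : ℕ) (y : Fin d → ℤ) (t : Fin d → Fin (n + 1)) (μ : Fin d) (ht : t μ = Fin.last n) :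
    blockMap (n + 1) ((blockBase (n + 1) y + fun i => ((t i : ℕ) : ℤ)) + e μ) μ = y μ + 1 := by
  have hM : ((n + 1 : ℕ) : ℤ) ≠ 0 := by exact_mod_cast Nat.succ_ne_zero n
  simp only [blockMap, blockBase, e, Pi.add_apply, Pi.single_eq_same, ht, Fin.val_last]
  have : ((n + 1 : ℕ) : ℤ) * y μ + ((n : ℕ) : ℤ) + 1 = ((n + 1 : ℕ) : ℤ) * (y μ + 1) := by push_cast; ring
  rw [this, Int.mul_ediv_cancel_left _ hM]

/-- `((n+1)y + t) + e_μ` lies in the block `B(y)` iff `t_μ ≠ n`. [folklore]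
[cite: Balaban1985RegularSpaces, p.79 (the blocks `Bʲ(y)`); Balaban1983RegularityDecay, (2.26) p.580] -/
theorem blockMap_chart_add_e_eq_iff (n : ℕ) (y : Fin d → ℤ) (t : Fin d → Fin (n + 1)) (μ : Fin d) :
    blockMap (n + 1) ((blockBase (n + 1) y + fun i => ((t i : ℕ) : ℤ)) + e μ) = y ↔ t μ ≠ Fin.last n := by
  constructor
  · intro h ht
    have h1 := congrFun h μ
    rw [blockMap_chart_add_e_of_last n y t μ ht] at h1
    linarith
  · intro ht
    rw [← chart_stepUp n y t μ ht, blockMap_chart]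

/-! ## §2 Sums over a block and over its internal bonds, through the chart -/

/-- A finite set that IS the block `B(y)` is the image of the chart. [folklore] [cite: Balaban1985RegularSpaces, p.79 (the blocks `Bʲ(y)`)] -/
theorem block_eq_image (n : ℕ) (y : Fin d → ℤ) (B : Finset (Fin d → ℤ)) (hB : ∀ x, x ∈ B ↔ blockMap (n + 1) x = y) :
    B = univ.image (fun t : Fin d → Fin (n + 1) => blockBase (n + 1) y + fun i => ((t i : ℕ) : ℤ)) := by
  ext x
  rw [hB, Finset.mem_image]
  constructor
  · intro hx
    obtain ⟨t, ht⟩ := exists_chart_eq hx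
    exact ⟨t, mem_univ _, ht⟩
  · rintro ⟨t, -, rfl⟩
    exact blockMap_chart n y t

/-- Sums over the block are sums over offsets. [folklore] [cite: Balaban1985RegularSpaces, p.79 (the blocks `Bʲ(y)`); Balaban1983RegularityDecay, (2.26) p.580] -/
theorem sum_block_eq (n : ℕ) (y : Fin d → ℤ) (B : Finset (Fin d → ℤ)) (hB : ∀ x, x ∈ B ↔ blockMap (n + 1) x = y)
    (F : (Fin d → ℤ) → ℝ) :
    ∑ x ∈ B, F x = ∑ t : Fin d → Fin (n + 1), F (blockBase (n + 1) y + fun i => ((t i : ℕ) : ℤ)) := by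
  rw [block_eq_image n y B hB, Finset.sum_image fun t _ t' _ h => chart_injective n y h]

/-- Sums over the bonds `⟨x, x + e_μ⟩` with both ends in the block are sums over the offsets with `t_μ ≠ n`. [folklore]
[cite: Balaban1983RegularityDecay, (2.26) p.580 (the bonds `b ⊂ Δ`); Balaban1985RegularSpaces, p.79] -/
theorem sum_blockBonds_eq (n : ℕ) (y : Fin d → ℤ) (B : Finset (Fin d → ℤ)) (hB : ∀ x, x ∈ B ↔ blockMap (n + 1) x = y)
    (μ : Fin d) (G : (Fin d → ℤ) → ℝ) :
    ∑ x ∈ B.filter (fun x => x + e μ ∈ B), G x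
      = ∑ t ∈ univ.filter (fun t : Fin d → Fin (n + 1) => t μ ≠ Fin.last n),
          G (blockBase (n + 1) y + fun i => ((t i : ℕ) : ℤ)) := by
  have hset : B.filter (fun x => x + e μ ∈ B) =
      (univ.filter (fun t : Fin d → Fin (n + 1) => t μ ≠ Fin.last n)).image
        (fun t : Fin d → Fin (n + 1) => blockBase (n + 1) y + fun i => ((t i : ℕ) : ℤ)) := by
    ext x
    simp only [Finset.mem_filter, Finset.mem_image, Finset.mem_univ, true_and]
    constructor
    · rintro ⟨hx, hxe⟩
      obtain ⟨t, rfl⟩ := exists_chart_eq ((hB _).mp hx)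
      exact ⟨t, (blockMap_chart_add_e_eq_iff n y t μ).mp ((hB _).mp hxe), rfl⟩
    · rintro ⟨t, ht, rfl⟩
      exact ⟨(hB _).mpr (blockMap_chart n y t), (hB _).mpr ((blockMap_chart_add_e_eq_iff n y t μ).mpr ht)⟩
  rw [hset, Finset.sum_image fun t _ t' _ h => chart_injective n y h]

/-- **[B4] (2.27) REPAIRED ON A BLOCK OF `ℤᵈ`** (transport of `B4Block227.block227_real` along the chart): for a finite `B = B(y)` of side
`n + 1`, every real `a′` and every `F : ℤᵈ → ℝ`,
`min{8, a′}·Σ_{x∈B} F(x)² ≤ (n+1)²·Σ_μ Σ_{x, x+e_μ ∈ B} (F(x+e_μ) − F(x))² + a′·(n+1)^{−d}·(Σ_{x∈B} F(x))²`.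
[cite: Balaban1983RegularityDecay, (2.27) p.580 (repaired constant `min{8,a}`); Balaban1984PropagatorsII, (2.26) p.235] -/
theorem block227_zd (n : ℕ) (y : Fin d → ℤ) (B : Finset (Fin d → ℤ)) (hB : ∀ x, x ∈ B ↔ blockMap (n + 1) x = y)
    (a' : ℝ) (F : (Fin d → ℤ) → ℝ) :
    min 8 a' * ∑ x ∈ B, F x ^ 2
      ≤ ((n : ℝ) + 1) ^ 2 * ∑ μ : Fin d, ∑ x ∈ B.filter (fun x => x + e μ ∈ B), (F x - F (x + e μ)) ^ 2
        + a' * (((n : ℝ) + 1) ^ d)⁻¹ * (∑ x ∈ B, F x) ^ 2 := by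
  have h := block227_real n d a' (fun t : Fin d → Fin (n + 1) => F (blockBase (n + 1) y + fun i => ((t i : ℕ) : ℤ)))
  rw [sum_block_eq n y B hB (fun x => F x ^ 2), sum_block_eq n y B hB F]
  have hb : ∀ μ : Fin d, ∑ x ∈ B.filter (fun x => x + e μ ∈ B), (F x - F (x + e μ)) ^ 2
      = ∑ t ∈ univ.filter (fun t : Fin d → Fin (n + 1) => t μ ≠ Fin.last n),
          (F (blockBase (n + 1) y + fun i => ((stepUp t μ i : ℕ) : ℤ)) - F (blockBase (n + 1) y + fun i => ((t i : ℕ) : ℤ))) ^ 2 := by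
    intro μ
    rw [sum_blockBonds_eq n y B hB μ (fun x => (F x - F (x + e μ)) ^ 2)]
    refine Finset.sum_congr rfl fun t ht => ?_
    rw [chart_stepUp n y t μ (Finset.mem_filter.mp ht).2]
    ring
  simp only [hb]
  exact h

/-! ## §3 The pieces of the flat Dirichlet multi-level form -/

/-- The Dirichlet-Laplacian part of the form in direction `μ` dominates the nearest-neighbour energy `Σ_{x∈S}(v_x − v_{x+e_μ})²` (the Dirichlet boundary
term of `B8Eq191FlatDirichletForm.quadForm_lap_flat_eq` is non-negative and dropped). [cite: Balaban1984PropagatorsII, (2.26) p.235; Balaban1985BackgroundPropagators, (3.23)–(3.24) p.394] -/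
theorem sq_le_lapForm (S : Finset (Fin d → ℤ)) (v : (Fin d → ℤ) → ℝ) (hv : ∀ w, w ∉ S → v w = 0) (μ : Fin d) :
    ∑ x ∈ S, (v x - v (x + e μ)) ^ 2 ≤
      ∑ x ∈ S, ∑ z ∈ S, v x * ((2 : ℝ) * (if z = x then (1 : ℝ) else 0) - (if z = x + e μ then (1 : ℝ) else 0)
        - (if z = x - e μ then (1 : ℝ) else 0)) * v z := by
  rw [quadForm_lap_flat_eq S v hv μ]
  exact le_add_of_nonneg_right (Finset.sum_nonneg fun x _ => by split_ifs <;> positivity)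

open Classical in
/-- **THE AVERAGING PART IS A SUM OF SQUARED BLOCK SUMS**: for a block map `y(·)`, a set `Λ` and a weight `c`,
`Σ_{x,z∈S} v_x[y(x) ∈ Λ ∧ y(z) = y(x)]c·v_z = c·Σ_{y ∈ y(S), y ∈ Λ} (Σ_{x∈S, y(x)=y} v_x)²`. [cite: Balaban1985BackgroundPropagators, (3.24) p.394; Balaban1984PropagatorsII, p.235] -/
theorem gramForm_eq_sum_sq (S : Finset (Fin d → ℤ)) (v : (Fin d → ℤ) → ℝ) (bm : (Fin d → ℤ) → (Fin d → ℤ)) (Λ : Set (Fin d → ℤ))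
    (c : ℝ) :
    ∑ x ∈ S, ∑ z ∈ S, v x * (if bm x ∈ Λ ∧ bm z = bm x then c else 0) * v z
      = c * ∑ y ∈ (S.image bm).filter (fun y => y ∈ Λ), (∑ x ∈ S.filter (fun x => bm x = y), v x) ^ 2 := by
  set W : (Fin d → ℤ) → ℝ := fun y => ∑ x ∈ S.filter (fun x => bm x = y), v x with hW
  have hWy : ∀ y, W y = ∑ z ∈ S, (if bm z = y then v z else 0) := fun y => by simp only [hW, Finset.sum_filter]
  have inner : ∀ x, ∑ z ∈ S, v x * (if bm x ∈ Λ ∧ bm z = bm x then c else 0) * v z =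
      if bm x ∈ Λ then c * v x * W (bm x) else 0 := by
    intro x
    by_cases hP : bm x ∈ Λ
    · rw [if_pos hP, hWy, Finset.mul_sum]
      exact Finset.sum_congr rfl fun z _ => by
        by_cases hz : bm z = bm x
        · rw [if_pos ⟨hP, hz⟩, if_pos hz]; ring
        · rw [if_neg (fun h => hz h.2), if_neg hz]; ring
    · rw [if_neg hP]
      exact Finset.sum_eq_zero fun z _ => by rw [if_neg (fun h => hP h.1)]; ring
  rw [Finset.sum_congr rfl fun x _ => inner x,
    ← Finset.sum_fiberwise_of_maps_to (s := S) (t := S.image bm) (g := bm) fun x hx => Finset.mem_image_of_mem bm hx]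
  have hfib : ∀ y ∈ S.image bm, ∑ x ∈ S.filter (fun x => bm x = y), (if bm x ∈ Λ then c * v x * W (bm x) else 0) =
      if y ∈ Λ then c * W y ^ 2 else 0 := by
    intro y _
    have h1 : ∑ x ∈ S.filter (fun x => bm x = y), (if bm x ∈ Λ then c * v x * W (bm x) else 0) =
        ∑ x ∈ S.filter (fun x => bm x = y), (if y ∈ Λ then c * W y * v x else 0) :=
      Finset.sum_congr rfl fun x hx => by
        have hx' : bm x = y := (Finset.mem_filter.mp hx).2
        rw [hx']
        split_ifs <;> ring
    rw [h1]
    by_cases hy : y ∈ Λ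
    · simp only [if_pos hy]
      have hWd : (∑ x ∈ S.filter (fun x => bm x = y), v x) = W y := rfl
      rw [← Finset.mul_sum, hWd]
      ring
    · simp only [if_neg hy, Finset.sum_const_zero]
  rw [Finset.sum_congr rfl hfib, ← Finset.sum_filter, Finset.mul_sum]

open Classical in
/-- **THE SPLIT OF THE FLAT DIRICHLET MULTI-LEVEL FORM** into its Laplacian part (per direction) and its averaging part (per level) — the kernel
`K` of `B8Eq191FlatStencils.flatDirichletOp_eq_sum_of_supp` read as a letter with its defining equation `hK`. [cite: Balaban1985RegularSpaces, (1.91) p.91; Balaban1985BackgroundPropagators, (3.24) p.394] -/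
theorem quadForm_flat_split {η : ℝ} (L m : ℕ) (Λs : ℕ → Set (Fin d → ℤ)) (a : ℕ → ℝ)
    (K : (Fin d → ℤ) → (Fin d → ℤ) → ℝ)
    (hK : ∀ x z, K x z = ((η ^ 2)⁻¹ * ∑ μ : Fin d, ((2 : ℝ) * (if z = x then (1 : ℝ) else 0) - (if z = x + e μ then (1 : ℝ) else 0)
        - (if z = x - e μ then (1 : ℝ) else 0))) +
        (∑ j ∈ Finset.range (m + 1), (if blockMap (L ^ j) x ∈ Λs j ∧ blockMap (L ^ j) z = blockMap (L ^ j) x then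
          a j * ((((L : ℝ) ^ d)⁻¹) ^ j) ^ 2 else 0)))
    (S : Finset (Fin d → ℤ)) (v : (Fin d → ℤ) → ℝ) :
    ∑ x ∈ S, ∑ z ∈ S, v x * K x z * v z =
      (η ^ 2)⁻¹ * ∑ μ : Fin d, ∑ x ∈ S, ∑ z ∈ S, v x * ((2 : ℝ) * (if z = x then (1 : ℝ) else 0)
        - (if z = x + e μ then (1 : ℝ) else 0) - (if z = x - e μ then (1 : ℝ) else 0)) * v z +
      ∑ j ∈ Finset.range (m + 1), ∑ x ∈ S, ∑ z ∈ S, v x * (if blockMap (L ^ j) x ∈ Λs j ∧ blockMap (L ^ j) z = blockMap (L ^ j) x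
        then a j * ((((L : ℝ) ^ d)⁻¹) ^ j) ^ 2 else 0) * v z := by
  have hterm : ∀ x z, v x * K x z * v z =
      (η ^ 2)⁻¹ * ∑ μ : Fin d, v x * ((2 : ℝ) * (if z = x then (1 : ℝ) else 0)
        - (if z = x + e μ then (1 : ℝ) else 0) - (if z = x - e μ then (1 : ℝ) else 0)) * v z +
      ∑ j ∈ Finset.range (m + 1), v x * (if blockMap (L ^ j) x ∈ Λs j ∧ blockMap (L ^ j) z = blockMap (L ^ j) x
        then a j * ((((L : ℝ) ^ d)⁻¹) ^ j) ^ 2 else 0) * v z := by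
    intro x z
    rw [hK, mul_add, add_mul]
    congr 1
    · simp only [Finset.mul_sum, Finset.sum_mul]
      exact Finset.sum_congr rfl fun μ _ => by ring
    · simp only [Finset.mul_sum, Finset.sum_mul]
  have hx : ∑ x ∈ S, ∑ z ∈ S, v x * K x z * v z =
      ∑ x ∈ S, ∑ z ∈ S, ((η ^ 2)⁻¹ * ∑ μ : Fin d, v x * ((2 : ℝ) * (if z = x then (1 : ℝ) else 0)
        - (if z = x + e μ then (1 : ℝ) else 0) - (if z = x - e μ then (1 : ℝ) else 0)) * v z) +
      ∑ x ∈ S, ∑ z ∈ S, ∑ j ∈ Finset.range (m + 1), v x * (if blockMap (L ^ j) x ∈ Λs j ∧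
        blockMap (L ^ j) z = blockMap (L ^ j) x then a j * ((((L : ℝ) ^ d)⁻¹) ^ j) ^ 2 else 0) * v z := by
    rw [← Finset.sum_add_distrib]
    refine Finset.sum_congr rfl fun x _ => ?_
    rw [← Finset.sum_add_distrib]
    exact Finset.sum_congr rfl fun z _ => hterm x z
  have hA : ∑ x ∈ S, ∑ z ∈ S, ((η ^ 2)⁻¹ * ∑ μ : Fin d, v x * ((2 : ℝ) * (if z = x then (1 : ℝ) else 0)
        - (if z = x + e μ then (1 : ℝ) else 0) - (if z = x - e μ then (1 : ℝ) else 0)) * v z) =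
      (η ^ 2)⁻¹ * ∑ μ : Fin d, ∑ x ∈ S, ∑ z ∈ S, v x * ((2 : ℝ) * (if z = x then (1 : ℝ) else 0)
        - (if z = x + e μ then (1 : ℝ) else 0) - (if z = x - e μ then (1 : ℝ) else 0)) * v z := by
    simp_rw [← Finset.mul_sum]
    congr 1
    simp_rw [Finset.sum_comm (s := S) (t := (Finset.univ : Finset (Fin d)))]
  have hB : ∑ x ∈ S, ∑ z ∈ S, ∑ j ∈ Finset.range (m + 1), v x * (if blockMap (L ^ j) x ∈ Λs j ∧
        blockMap (L ^ j) z = blockMap (L ^ j) x then a j * ((((L : ℝ) ^ d)⁻¹) ^ j) ^ 2 else 0) * v z =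
      ∑ j ∈ Finset.range (m + 1), ∑ x ∈ S, ∑ z ∈ S, v x * (if blockMap (L ^ j) x ∈ Λs j ∧
        blockMap (L ^ j) z = blockMap (L ^ j) x then a j * ((((L : ℝ) ^ d)⁻¹) ^ j) ^ 2 else 0) * v z := by
    simp_rw [Finset.sum_comm (s := S) (t := Finset.range (m + 1))]
  rw [hx, hA, hB]

/-! ## §4 Tower blocks: the level-`j` blocks `B^j(y)`, `y ∈ Λ_j`, read inside `S` -/

open Classical in
/-- Splitting the level-`j` tower sites of `S` into their blocks: `Σ_{x∈S, y_j(x)∈Λ_j} g(x) = Σ_{y ∈ y_j(S), y∈Λ_j} Σ_{x∈S, y_j(x)=y} g(x)`. [folklore]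
[cite: Balaban1985RegularSpaces, (1.5)–(1.6) p.77 (the towers `Bʲ(Λ_j)`)] -/
theorem sum_towerSites_eq_sum_blocks (S : Finset (Fin d → ℤ)) (bm : (Fin d → ℤ) → (Fin d → ℤ)) (Λ : Set (Fin d → ℤ))
    (g : (Fin d → ℤ) → ℝ) :
    ∑ x ∈ S.filter (fun x => bm x ∈ Λ), g x
      = ∑ y ∈ (S.image bm).filter (fun y => y ∈ Λ), ∑ x ∈ S.filter (fun x => bm x = y), g x := by
  rw [← Finset.sum_fiberwise_of_maps_to (s := S.filter (fun x => bm x ∈ Λ)) (t := (S.image bm).filter (fun y => y ∈ Λ))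
    (g := bm) fun x hx => Finset.mem_filter.mpr ⟨Finset.mem_image_of_mem bm (Finset.mem_filter.mp hx).1, (Finset.mem_filter.mp hx).2⟩]
  refine Finset.sum_congr rfl fun y hy => ?_
  have hyΛ : y ∈ Λ := (Finset.mem_filter.mp hy).2
  congr 1
  ext x
  simp only [Finset.mem_filter]
  constructor
  · rintro ⟨⟨hxS, -⟩, hxy⟩; exact ⟨hxS, hxy⟩
  · rintro ⟨hxS, hxy⟩; exact ⟨⟨hxS, by rw [hxy]; exact hyΛ⟩, hxy⟩

open Classical in
/-- **A SITE LIES IN AT MOST ONE TOWER BLOCK ⇒ THE TOWER BLOCKS UNDER-COUNT `S`**: for `g ≥ 0` on `S`,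
`Σ_{j≤m} Σ_{y ∈ y_j(S), y∈Λ_j} Σ_{x∈S, y_j(x)=y} g(x) ≤ Σ_{x∈S} g(x)`. [cite: Balaban1985RegularSpaces, (1.5)–(1.6) p.77 (the towers `B^j(Λ_j)` are disjoint)] -/
theorem sum_towerBlocks_le (S : Finset (Fin d → ℤ)) (L m : ℕ) (Λs : ℕ → Set (Fin d → ℤ))
    (hdisj : ∀ x ∈ S, ∀ j, j ≤ m → ∀ j', j' ≤ m → blockMap (L ^ j) x ∈ Λs j → blockMap (L ^ j') x ∈ Λs j' → j = j')
    (g : (Fin d → ℤ) → ℝ) (hg : ∀ x ∈ S, 0 ≤ g x) :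
    ∑ j ∈ Finset.range (m + 1), ∑ y ∈ (S.image (blockMap (L ^ j))).filter (fun y => y ∈ Λs j),
        ∑ x ∈ S.filter (fun x => blockMap (L ^ j) x = y), g x
      ≤ ∑ x ∈ S, g x := by
  have h1 : ∀ j, ∑ y ∈ (S.image (blockMap (L ^ j))).filter (fun y => y ∈ Λs j), ∑ x ∈ S.filter (fun x => blockMap (L ^ j) x = y), g x
      = ∑ x ∈ S, (if blockMap (L ^ j) x ∈ Λs j then g x else 0) := by
    intro j
    rw [← sum_towerSites_eq_sum_blocks S (blockMap (L ^ j)) (Λs j) g, Finset.sum_filter]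
  rw [Finset.sum_congr rfl fun j _ => h1 j, Finset.sum_comm]
  refine Finset.sum_le_sum fun x hx => ?_
  rw [← Finset.sum_filter]
  have hcard : ((Finset.range (m + 1)).filter (fun j => blockMap (L ^ j) x ∈ Λs j)).card ≤ 1 := by
    refine Finset.card_le_one.mpr fun j hj j' hj' => ?_
    have hj1 := Finset.mem_filter.mp hj
    have hj2 := Finset.mem_filter.mp hj'
    exact hdisj x hx j (Nat.lt_succ_iff.mp (Finset.mem_range.mp hj1.1)) j' (Nat.lt_succ_iff.mp (Finset.mem_range.mp hj2.1)) hj1.2 hj2.2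
  rw [Finset.sum_const, nsmul_eq_mul]
  calc (((Finset.range (m + 1)).filter (fun j => blockMap (L ^ j) x ∈ Λs j)).card : ℝ) * g x ≤ 1 * g x := by
        exact mul_le_mul_of_nonneg_right (by exact_mod_cast hcard) (hg x hx)
    _ = g x := one_mul _

/-! ## §5 The weighted lower bound -/

/-- **THE WEIGHTED BLOCK INEQUALITY** (one tower block `B = B^j(y) ⊂ ℤᵈ`, weight `a_j`): with `a′_j = a_j η² L^{2j} L^{−dj}`,
`min{8, a′_j}·(Lʲη)⁻²·Σ_B v² ≤ η⁻²·Σ_μ Σ_{x, x+e_μ ∈ B}(v_x − v_{x+e_μ})² + a_j L^{−2dj}·(Σ_B v)²` — `block227_zd` multiplied by `(Lʲη)⁻²`.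
[cite: Balaban1984PropagatorsII, (2.26)–(2.27) p.235; Balaban1983RegularityDecay, (2.27) p.580] -/
theorem towerBlock_weighted {η : ℝ} (hη : η ≠ 0) {L : ℕ} (hL : 1 ≤ L) (j : ℕ) (aj : ℝ) (y : Fin d → ℤ)
    (B : Finset (Fin d → ℤ)) (hB : ∀ x, x ∈ B ↔ blockMap (L ^ j) x = y) (v : (Fin d → ℤ) → ℝ) :
    min 8 (aj * η ^ 2 * ((L : ℝ) ^ j) ^ 2 * (((L : ℝ) ^ d) ^ j)⁻¹) * (((L : ℝ) ^ j * η) ^ 2)⁻¹ * ∑ x ∈ B, v x ^ 2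
      ≤ (η ^ 2)⁻¹ * ∑ μ : Fin d, ∑ x ∈ B.filter (fun x => x + e μ ∈ B), (v x - v (x + e μ)) ^ 2
        + aj * ((((L : ℝ) ^ d)⁻¹) ^ j) ^ 2 * (∑ x ∈ B, v x) ^ 2 := by
  obtain ⟨n, hn⟩ : ∃ n, L ^ j = n + 1 := Nat.exists_eq_succ_of_ne_zero (pow_ne_zero j (by omega))
  have hB' : ∀ x, x ∈ B ↔ blockMap (n + 1) x = y := by rw [← hn]; exact hB
  have hnR : ((n : ℝ) + 1) = (L : ℝ) ^ j := by exact_mod_cast hn.symm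
  have hL0 : (L : ℝ) ≠ 0 := by exact_mod_cast (show L ≠ 0 by omega)
  have hLj : (L : ℝ) ^ j ≠ 0 := pow_ne_zero j hL0
  have hLdj : ((L : ℝ) ^ d) ^ j ≠ 0 := pow_ne_zero j (pow_ne_zero d hL0)
  have hW0 : 0 ≤ (((L : ℝ) ^ j * η) ^ 2)⁻¹ := by positivity
  have h227 := block227_zd n y B hB' (aj * η ^ 2 * ((L : ℝ) ^ j) ^ 2 * (((L : ℝ) ^ d) ^ j)⁻¹) v
  rw [hnR] at h227
  have hW1 : (((L : ℝ) ^ j * η) ^ 2)⁻¹ * ((L : ℝ) ^ j) ^ 2 = (η ^ 2)⁻¹ := by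
    field_simp
  have hpow : ((L : ℝ) ^ j) ^ d = ((L : ℝ) ^ d) ^ j := by rw [← pow_mul, ← pow_mul, mul_comm]
  have hcoef : (((L : ℝ) ^ j * η) ^ 2)⁻¹ * ((aj * η ^ 2 * ((L : ℝ) ^ j) ^ 2 * (((L : ℝ) ^ d) ^ j)⁻¹) * (((L : ℝ) ^ j) ^ d)⁻¹)
      = aj * ((((L : ℝ) ^ d)⁻¹) ^ j) ^ 2 := by
    rw [hpow, inv_pow]
    field_simp
  have key := mul_le_mul_of_nonneg_left h227 hW0
  calc min 8 (aj * η ^ 2 * ((L : ℝ) ^ j) ^ 2 * (((L : ℝ) ^ d) ^ j)⁻¹) * (((L : ℝ) ^ j * η) ^ 2)⁻¹ * ∑ x ∈ B, v x ^ 2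
        = (((L : ℝ) ^ j * η) ^ 2)⁻¹ * (min 8 (aj * η ^ 2 * ((L : ℝ) ^ j) ^ 2 * (((L : ℝ) ^ d) ^ j)⁻¹) * ∑ x ∈ B, v x ^ 2) := by ring
    _ ≤ (((L : ℝ) ^ j * η) ^ 2)⁻¹ * (((L : ℝ) ^ j) ^ 2 * ∑ μ : Fin d, ∑ x ∈ B.filter (fun x => x + e μ ∈ B), (v x - v (x + e μ)) ^ 2
          + (aj * η ^ 2 * ((L : ℝ) ^ j) ^ 2 * (((L : ℝ) ^ d) ^ j)⁻¹) * (((L : ℝ) ^ j) ^ d)⁻¹ * (∑ x ∈ B, v x) ^ 2) := key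
    _ = ((((L : ℝ) ^ j * η) ^ 2)⁻¹ * ((L : ℝ) ^ j) ^ 2) * ∑ μ : Fin d, ∑ x ∈ B.filter (fun x => x + e μ ∈ B), (v x - v (x + e μ)) ^ 2
          + ((((L : ℝ) ^ j * η) ^ 2)⁻¹ * ((aj * η ^ 2 * ((L : ℝ) ^ j) ^ 2 * (((L : ℝ) ^ d) ^ j)⁻¹) * (((L : ℝ) ^ j) ^ d)⁻¹))
            * (∑ x ∈ B, v x) ^ 2 := by ring
    _ = (η ^ 2)⁻¹ * ∑ μ : Fin d, ∑ x ∈ B.filter (fun x => x + e μ ∈ B), (v x - v (x + e μ)) ^ 2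
          + aj * ((((L : ℝ) ^ d)⁻¹) ^ j) ^ 2 * (∑ x ∈ B, v x) ^ 2 := by rw [hW1, hcoef]

open Classical in
/-- **THE `k`-UNIFORM WEIGHTED LOWER BOUND OF THE FLAT DIRICHLET MULTI-LEVEL FORM** ([B6] (2.26)–(2.27) ∕ [4] (3.24) at `U₀ = 1`, Dirichlet on `S`):
for `v` supported in a finite `S ⊂ ℤᵈ`, the kernel `K` of `B8Eq191FlatStencils.flatDirichletOp_eq_sum_of_supp` (letters `η, L, m, Λs, a` with the defining
equation `hK`), and a tower geometry in which every block `B^j(y)`, `y ∈ Λ_j` meeting `S`, lies in `S` (`hfull`) and every site of `S` lies in at most one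
tower block (`hdisj`):
`Σ_{j≤m} min{8, a_jη²L^{2j}L^{−dj}}·(Lʲη)⁻²·Σ_{x∈S : B^j(x)∈Λ_j} v(x)² ≤ Σ_{x,z∈S} v(x)K(x,z)v(z)`.
Mechanism: the form splits into `η⁻²Σ_μ`(nearest-neighbour energy + Dirichlet boundary term) + `Σ_j a_jL^{−2dj}Σ_{y∈Λ_j}(Σ_{B^j(y)} v)²`
(`quadForm_flat_split`, `gramForm_eq_sum_sq`); on each tower block the repaired block inequality (2.27) (`towerBlock_weighted`) is paid for by the
block's internal bonds and its own squared block sum; distinct tower blocks use disjoint bonds (`sum_towerBlocks_le`). No largeness condition, no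
threshold: the constant at level `j` is `min{8, a′_j}`.
[cite: Balaban1984PropagatorsII, (2.26)–(2.27) p.235, p.228 («G(Ω) = (ΩΔ_aΩ)⁻¹»); Balaban1985BackgroundPropagators, (3.24) p.394; Balaban1985RegularSpaces, (1.91) p.91] -/
theorem weighted_coercive_flatDirichlet {η : ℝ} (hη : η ≠ 0) {L : ℕ} (hL : 1 ≤ L) (m : ℕ) (Λs : ℕ → Set (Fin d → ℤ)) (a : ℕ → ℝ)
    (K : (Fin d → ℤ) → (Fin d → ℤ) → ℝ)
    (hK : ∀ x z, K x z = ((η ^ 2)⁻¹ * ∑ μ : Fin d, ((2 : ℝ) * (if z = x then (1 : ℝ) else 0) - (if z = x + e μ then (1 : ℝ) else 0)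
        - (if z = x - e μ then (1 : ℝ) else 0))) +
        (∑ j ∈ Finset.range (m + 1), (if blockMap (L ^ j) x ∈ Λs j ∧ blockMap (L ^ j) z = blockMap (L ^ j) x then
          a j * ((((L : ℝ) ^ d)⁻¹) ^ j) ^ 2 else 0)))
    (S : Finset (Fin d → ℤ)) (v : (Fin d → ℤ) → ℝ) (hv : ∀ w, w ∉ S → v w = 0)
    (hfull : ∀ j, j ≤ m → ∀ x ∈ S, blockMap (L ^ j) x ∈ Λs j → ∀ z, blockMap (L ^ j) z = blockMap (L ^ j) x → z ∈ S)
    (hdisj : ∀ x ∈ S, ∀ j, j ≤ m → ∀ j', j' ≤ m → blockMap (L ^ j) x ∈ Λs j → blockMap (L ^ j') x ∈ Λs j' → j = j') :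
    ∑ j ∈ Finset.range (m + 1), min 8 (a j * η ^ 2 * ((L : ℝ) ^ j) ^ 2 * (((L : ℝ) ^ d) ^ j)⁻¹) * (((L : ℝ) ^ j * η) ^ 2)⁻¹ *
        ∑ x ∈ S.filter (fun x => blockMap (L ^ j) x ∈ Λs j), v x ^ 2
      ≤ ∑ x ∈ S, ∑ z ∈ S, v x * K x z * v z := by
  -- the tower blocks read inside `S` are genuine blocks of `ℤᵈ`
  have hBl : ∀ j, j ≤ m → ∀ y ∈ ((S.image (blockMap (L ^ j))).filter (fun y => y ∈ Λs j)), ∀ x, x ∈ (S.filter (fun x => blockMap (L ^ j) x = y)) ↔ blockMap (L ^ j) x = y := by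
    intro j hj y hy x
    obtain ⟨hy1, hy2⟩ := Finset.mem_filter.mp hy
    obtain ⟨x₀, hx₀S, hx₀y⟩ := Finset.mem_image.mp hy1
    rw [Finset.mem_filter]
    constructor
    · exact fun h => h.2
    · intro hxy
      exact ⟨hfull j hj x₀ hx₀S (by rw [hx₀y]; exact hy2) x (by rw [hxy, hx₀y]), hxy⟩
  -- per tower block: the weighted block inequality
  have hPB : ∀ j ∈ Finset.range (m + 1), ∀ y ∈ ((S.image (blockMap (L ^ j))).filter (fun y => y ∈ Λs j)),
      min 8 (a j * η ^ 2 * ((L : ℝ) ^ j) ^ 2 * (((L : ℝ) ^ d) ^ j)⁻¹) * (((L : ℝ) ^ j * η) ^ 2)⁻¹ * ∑ x ∈ (S.filter (fun x => blockMap (L ^ j) x = y)), v x ^ 2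
        ≤ (η ^ 2)⁻¹ * ∑ μ : Fin d, ∑ x ∈ ((S.filter (fun x => blockMap (L ^ j) x = y)).filter (fun x => x + e μ ∈ S.filter (fun x => blockMap (L ^ j) x = y))), (v x - v (x + e μ)) ^ 2
          + (a j * ((((L : ℝ) ^ d)⁻¹) ^ j) ^ 2) * (∑ x ∈ (S.filter (fun x => blockMap (L ^ j) x = y)), v x) ^ 2 := by
    intro j hj y hy
    exact towerBlock_weighted hη hL j (a j) y (S.filter (fun x => blockMap (L ^ j) x = y)) (hBl j (Nat.lt_succ_iff.mp (Finset.mem_range.mp hj)) y hy) v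
  -- the bonds: tower blocks use disjoint bonds of `S`, and the Dirichlet-Laplacian part pays for all of them
  have hbond : ∑ j ∈ Finset.range (m + 1), ∑ y ∈ ((S.image (blockMap (L ^ j))).filter (fun y => y ∈ Λs j)), ∑ μ : Fin d, ∑ x ∈ ((S.filter (fun x => blockMap (L ^ j) x = y)).filter (fun x => x + e μ ∈ S.filter (fun x => blockMap (L ^ j) x = y))), (v x - v (x + e μ)) ^ 2
      ≤ ∑ μ : Fin d, ∑ x ∈ S, ∑ z ∈ S, v x * ((2 : ℝ) * (if z = x then (1 : ℝ) else 0)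
        - (if z = x + e μ then (1 : ℝ) else 0) - (if z = x - e μ then (1 : ℝ) else 0)) * v z := by
    calc ∑ j ∈ Finset.range (m + 1), ∑ y ∈ ((S.image (blockMap (L ^ j))).filter (fun y => y ∈ Λs j)), ∑ μ : Fin d, ∑ x ∈ ((S.filter (fun x => blockMap (L ^ j) x = y)).filter (fun x => x + e μ ∈ S.filter (fun x => blockMap (L ^ j) x = y))), (v x - v (x + e μ)) ^ 2
        ≤ ∑ j ∈ Finset.range (m + 1), ∑ y ∈ ((S.image (blockMap (L ^ j))).filter (fun y => y ∈ Λs j)), ∑ μ : Fin d, ∑ x ∈ (S.filter (fun x => blockMap (L ^ j) x = y)), (v x - v (x + e μ)) ^ 2 := by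
          refine Finset.sum_le_sum fun j _ => Finset.sum_le_sum fun y _ => Finset.sum_le_sum fun μ _ => ?_
          exact Finset.sum_le_sum_of_subset_of_nonneg (Finset.filter_subset _ _) fun x _ _ => sq_nonneg _
      _ = ∑ μ : Fin d, ∑ j ∈ Finset.range (m + 1), ∑ y ∈ ((S.image (blockMap (L ^ j))).filter (fun y => y ∈ Λs j)), ∑ x ∈ (S.filter (fun x => blockMap (L ^ j) x = y)), (v x - v (x + e μ)) ^ 2 := by
          rw [Finset.sum_comm]
          exact Finset.sum_congr rfl fun j _ => Finset.sum_comm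
      _ ≤ ∑ μ : Fin d, ∑ x ∈ S, (v x - v (x + e μ)) ^ 2 :=
          Finset.sum_le_sum fun μ _ => sum_towerBlocks_le S L m Λs hdisj (fun x => (v x - v (x + e μ)) ^ 2) fun x _ => sq_nonneg _
      _ ≤ ∑ μ : Fin d, ∑ x ∈ S, ∑ z ∈ S, v x * ((2 : ℝ) * (if z = x then (1 : ℝ) else 0)
        - (if z = x + e μ then (1 : ℝ) else 0) - (if z = x - e μ then (1 : ℝ) else 0)) * v z := Finset.sum_le_sum fun μ _ => sq_le_lapForm S v hv μ
  -- the squared block sums ARE the averaging part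
  have hgram : ∀ j, ∑ x ∈ S, ∑ z ∈ S, v x * (if blockMap (L ^ j) x ∈ Λs j ∧ blockMap (L ^ j) z = blockMap (L ^ j) x
        then a j * ((((L : ℝ) ^ d)⁻¹) ^ j) ^ 2 else 0) * v z = (a j * ((((L : ℝ) ^ d)⁻¹) ^ j) ^ 2) * ∑ y ∈ ((S.image (blockMap (L ^ j))).filter (fun y => y ∈ Λs j)), (∑ x ∈ (S.filter (fun x => blockMap (L ^ j) x = y)), v x) ^ 2 :=
    fun j => gramForm_eq_sum_sq S v (blockMap (L ^ j)) (Λs j) (a j * ((((L : ℝ) ^ d)⁻¹) ^ j) ^ 2)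
  -- assembly
  calc ∑ j ∈ Finset.range (m + 1), min 8 (a j * η ^ 2 * ((L : ℝ) ^ j) ^ 2 * (((L : ℝ) ^ d) ^ j)⁻¹) * (((L : ℝ) ^ j * η) ^ 2)⁻¹ * ∑ x ∈ S.filter (fun x => blockMap (L ^ j) x ∈ Λs j), v x ^ 2
      = ∑ j ∈ Finset.range (m + 1), ∑ y ∈ ((S.image (blockMap (L ^ j))).filter (fun y => y ∈ Λs j)), min 8 (a j * η ^ 2 * ((L : ℝ) ^ j) ^ 2 * (((L : ℝ) ^ d) ^ j)⁻¹) * (((L : ℝ) ^ j * η) ^ 2)⁻¹ * ∑ x ∈ (S.filter (fun x => blockMap (L ^ j) x = y)), v x ^ 2 := by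
        refine Finset.sum_congr rfl fun j _ => ?_
        rw [sum_towerSites_eq_sum_blocks S (blockMap (L ^ j)) (Λs j) (fun x => v x ^ 2), Finset.mul_sum]
    _ ≤ ∑ j ∈ Finset.range (m + 1), ∑ y ∈ ((S.image (blockMap (L ^ j))).filter (fun y => y ∈ Λs j)),
          ((η ^ 2)⁻¹ * ∑ μ : Fin d, ∑ x ∈ ((S.filter (fun x => blockMap (L ^ j) x = y)).filter (fun x => x + e μ ∈ S.filter (fun x => blockMap (L ^ j) x = y))), (v x - v (x + e μ)) ^ 2 + (a j * ((((L : ℝ) ^ d)⁻¹) ^ j) ^ 2) * (∑ x ∈ (S.filter (fun x => blockMap (L ^ j) x = y)), v x) ^ 2) :=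
        Finset.sum_le_sum fun j hj => Finset.sum_le_sum fun y hy => hPB j hj y hy
    _ = (η ^ 2)⁻¹ * ∑ j ∈ Finset.range (m + 1), ∑ y ∈ ((S.image (blockMap (L ^ j))).filter (fun y => y ∈ Λs j)), ∑ μ : Fin d, ∑ x ∈ ((S.filter (fun x => blockMap (L ^ j) x = y)).filter (fun x => x + e μ ∈ S.filter (fun x => blockMap (L ^ j) x = y))), (v x - v (x + e μ)) ^ 2
          + ∑ j ∈ Finset.range (m + 1), (a j * ((((L : ℝ) ^ d)⁻¹) ^ j) ^ 2) * ∑ y ∈ ((S.image (blockMap (L ^ j))).filter (fun y => y ∈ Λs j)), (∑ x ∈ (S.filter (fun x => blockMap (L ^ j) x = y)), v x) ^ 2 := by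
        simp only [Finset.sum_add_distrib, Finset.mul_sum]
    _ ≤ (η ^ 2)⁻¹ * ∑ μ : Fin d, ∑ x ∈ S, ∑ z ∈ S, v x * ((2 : ℝ) * (if z = x then (1 : ℝ) else 0)
        - (if z = x + e μ then (1 : ℝ) else 0) - (if z = x - e μ then (1 : ℝ) else 0)) * v z
          + ∑ j ∈ Finset.range (m + 1), ∑ x ∈ S, ∑ z ∈ S, v x * (if blockMap (L ^ j) x ∈ Λs j ∧ blockMap (L ^ j) z = blockMap (L ^ j) x
        then a j * ((((L : ℝ) ^ d)⁻¹) ^ j) ^ 2 else 0) * v z := by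
        refine add_le_add (mul_le_mul_of_nonneg_left hbond (inv_nonneg.mpr (sq_nonneg η))) (le_of_eq ?_)
        exact Finset.sum_congr rfl fun j _ => (hgram j).symm
    _ = ∑ x ∈ S, ∑ z ∈ S, v x * K x z * v z := (quadForm_flat_split L m Λs a K hK S v).symm

open Classical in
/-- **UNIFORM FORM**: if one constant `a₀ ≤ 8` sits below every level weight, `a₀ ≤ a_j η² L^{2j} L^{−dj}` (`j ≤ m`) — e.g. print's weights
`a_j = a₀·η⁻²·L^{(d−2)j}`, [4] (3.24) with B8's `(Lʲη)`-scaling — then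
`a₀ · Σ_{j≤m} (Lʲη)⁻² Σ_{x∈S : B^j(x)∈Λ_j} v(x)² ≤ Σ_{x,z∈S} v(x)K(x,z)v(z)`: ONE constant, uniform in `k`, `η`, `m`, `S` and the tower geometry.
[cite: Balaban1984PropagatorsII, (2.26)–(2.27) p.235; Balaban1985BackgroundPropagators, (3.24) p.394; Balaban1985RegularSpaces, (1.91) p.91] -/
theorem weighted_coercive_flatDirichlet_uniform {η : ℝ} (hη : η ≠ 0) {L : ℕ} (hL : 1 ≤ L) (m : ℕ) (Λs : ℕ → Set (Fin d → ℤ)) (a : ℕ → ℝ)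
    (K : (Fin d → ℤ) → (Fin d → ℤ) → ℝ)
    (hK : ∀ x z, K x z = ((η ^ 2)⁻¹ * ∑ μ : Fin d, ((2 : ℝ) * (if z = x then (1 : ℝ) else 0) - (if z = x + e μ then (1 : ℝ) else 0)
        - (if z = x - e μ then (1 : ℝ) else 0))) +
        (∑ j ∈ Finset.range (m + 1), (if blockMap (L ^ j) x ∈ Λs j ∧ blockMap (L ^ j) z = blockMap (L ^ j) x then
          a j * ((((L : ℝ) ^ d)⁻¹) ^ j) ^ 2 else 0)))
    (S : Finset (Fin d → ℤ)) (v : (Fin d → ℤ) → ℝ) (hv : ∀ w, w ∉ S → v w = 0)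
    (hfull : ∀ j, j ≤ m → ∀ x ∈ S, blockMap (L ^ j) x ∈ Λs j → ∀ z, blockMap (L ^ j) z = blockMap (L ^ j) x → z ∈ S)
    (hdisj : ∀ x ∈ S, ∀ j, j ≤ m → ∀ j', j' ≤ m → blockMap (L ^ j) x ∈ Λs j → blockMap (L ^ j') x ∈ Λs j' → j = j')
    {a₀ : ℝ} (ha₀ : a₀ ≤ 8) (ha : ∀ j, j ≤ m → a₀ ≤ a j * η ^ 2 * ((L : ℝ) ^ j) ^ 2 * (((L : ℝ) ^ d) ^ j)⁻¹) :
    a₀ * ∑ j ∈ Finset.range (m + 1), (((L : ℝ) ^ j * η) ^ 2)⁻¹ * ∑ x ∈ S.filter (fun x => blockMap (L ^ j) x ∈ Λs j), v x ^ 2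
      ≤ ∑ x ∈ S, ∑ z ∈ S, v x * K x z * v z := by
  refine le_trans ?_ (weighted_coercive_flatDirichlet hη hL m Λs a K hK S v hv hfull hdisj)
  rw [Finset.mul_sum]
  refine Finset.sum_le_sum fun j hj => ?_
  have hmin : a₀ ≤ min 8 (a j * η ^ 2 * ((L : ℝ) ^ j) ^ 2 * (((L : ℝ) ^ d) ^ j)⁻¹) := le_min ha₀ (ha j (Nat.lt_succ_iff.mp (Finset.mem_range.mp hj)))
  have hnn : 0 ≤ (((L : ℝ) ^ j * η) ^ 2)⁻¹ * ∑ x ∈ S.filter (fun x => blockMap (L ^ j) x ∈ Λs j), v x ^ 2 :=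
    mul_nonneg (by positivity) (Finset.sum_nonneg fun x _ => sq_nonneg _)
  calc a₀ * ((((L : ℝ) ^ j * η) ^ 2)⁻¹ * ∑ x ∈ S.filter (fun x => blockMap (L ^ j) x ∈ Λs j), v x ^ 2)
      ≤ min 8 (a j * η ^ 2 * ((L : ℝ) ^ j) ^ 2 * (((L : ℝ) ^ d) ^ j)⁻¹) * ((((L : ℝ) ^ j * η) ^ 2)⁻¹ * ∑ x ∈ S.filter (fun x => blockMap (L ^ j) x ∈ Λs j), v x ^ 2) :=
        mul_le_mul_of_nonneg_right hmin hnn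
    _ = min 8 (a j * η ^ 2 * ((L : ℝ) ^ j) ^ 2 * (((L : ℝ) ^ d) ^ j)⁻¹) * (((L : ℝ) ^ j * η) ^ 2)⁻¹ * ∑ x ∈ S.filter (fun x => blockMap (L ^ j) x ∈ Λs j), v x ^ 2 := by ring

open Classical in
/-- **MATRIX FORM** on the real matrix `T = (K(x,z))_{x,z∈S}` of `B8Eq191FlatDirichletForm.isUnit_flatMatrix` (the matrix the flat letters invert): for
`u : S → ℝ`, with `v` its extension by zero,
`Σ_{j≤m} min{8, a′_j}·(Lʲη)⁻²·Σ_{x∈S : B^j(x)∈Λ_j} v(x)² ≤ ⟨u, T u⟩`. [cite: Balaban1985RegularSpaces, (1.91) p.91; Balaban1984PropagatorsII, (2.26)–(2.27) p.235] -/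
theorem weighted_coercive_flatMatrix {η : ℝ} (hη : η ≠ 0) {L : ℕ} (hL : 1 ≤ L) (m : ℕ) (Λs : ℕ → Set (Fin d → ℤ)) (a : ℕ → ℝ)
    (K : (Fin d → ℤ) → (Fin d → ℤ) → ℝ)
    (hK : ∀ x z, K x z = ((η ^ 2)⁻¹ * ∑ μ : Fin d, ((2 : ℝ) * (if z = x then (1 : ℝ) else 0) - (if z = x + e μ then (1 : ℝ) else 0)
        - (if z = x - e μ then (1 : ℝ) else 0))) +
        (∑ j ∈ Finset.range (m + 1), (if blockMap (L ^ j) x ∈ Λs j ∧ blockMap (L ^ j) z = blockMap (L ^ j) x then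
          a j * ((((L : ℝ) ^ d)⁻¹) ^ j) ^ 2 else 0)))
    (S : Finset (Fin d → ℤ))
    (hfull : ∀ j, j ≤ m → ∀ x ∈ S, blockMap (L ^ j) x ∈ Λs j → ∀ z, blockMap (L ^ j) z = blockMap (L ^ j) x → z ∈ S)
    (hdisj : ∀ x ∈ S, ∀ j, j ≤ m → ∀ j', j' ≤ m → blockMap (L ^ j) x ∈ Λs j → blockMap (L ^ j') x ∈ Λs j' → j = j')
    (u : ↥S → ℝ) :
    ∑ j ∈ Finset.range (m + 1), min 8 (a j * η ^ 2 * ((L : ℝ) ^ j) ^ 2 * (((L : ℝ) ^ d) ^ j)⁻¹) * (((L : ℝ) ^ j * η) ^ 2)⁻¹ *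
        ∑ x ∈ S.filter (fun x => blockMap (L ^ j) x ∈ Λs j), (if h : x ∈ S then u ⟨x, h⟩ else 0) ^ 2
      ≤ u ⬝ᵥ (Matrix.of (fun x z : ↥S => K x.1 z.1)).mulVec u := by
  set v : (Fin d → ℤ) → ℝ := fun x => if h : x ∈ S then u ⟨x, h⟩ else 0 with hvdef
  have hv : ∀ w, w ∉ S → v w = 0 := fun w hw => by simp only [hvdef, dif_neg hw]
  have hvu : ∀ x : ↥S, v x.1 = u x := fun x => by simp only [hvdef, dif_pos x.2]
  have hform : u ⬝ᵥ (Matrix.of (fun x z : ↥S => K x.1 z.1)).mulVec u = ∑ x ∈ S, ∑ z ∈ S, v x * K x z * v z := by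
    simp only [dotProduct, Matrix.mulVec, Matrix.of_apply]
    rw [← Finset.sum_coe_sort S]
    refine Finset.sum_congr rfl fun x _ => ?_
    rw [Finset.mul_sum, ← Finset.sum_coe_sort S]
    refine Finset.sum_congr rfl fun z _ => ?_
    rw [hvu x, hvu z]
    ring
  rw [hform]
  exact weighted_coercive_flatDirichlet hη hL m Λs a K hK S v hv hfull hdisj

/-! ## §6 The instance at the concrete cube member `{□_j}` of [Balaban1985RegularSpaces] (1.131) -/

/-- **Tower blocks of the cube member lie in `□₀`**: a block `B^j(y)` with `y ∈ Λs_n(j)` (the truncated restriction sets `cubeLamS` of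
`B8CubeMemberZd`, `n ≤ k`) lies in `□_j ⊂ □₀`. [cite: Balaban1985RegularSpaces, (1.5)–(1.6) p.77, (1.131) p.99] -/
theorem towerBlock_subset_cube {L : ℕ} (hL : 1 ≤ L) (a : Fin d → ℤ) (M : ℕ) {ρ : ℕ} (hρ : L ≤ ρ) {k n : ℕ} (hn : n ≤ k)
    {j : ℕ} (hj : j ≤ n) {y z : Fin d → ℤ} (hy : y ∈ cubeLamS L a M ρ k n j) (hz : blockMap (L ^ j) z = y) :
    z ∈ cubeFam false L a M ρ k 0 := by
  have h1 : z ∈ cube L a M ρ k j := (mem_cube_iff hL).mpr ⟨y, inBox_sq_of_mem_cubeLamS hy, (under_iff_blockMap_eq hL j y z).mpr hz⟩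
  rw [← cubeFam_false_of_le L a M ρ (hj.trans hn)] at h1
  exact cubeFam_subset_zero hL a M hρ k j h1

open Classical in
/-- **THE `k`-UNIFORM WEIGHTED LOWER BOUND AT THE CUBE MEMBER** — the flat Dirichlet multi-level matrix `T` of
`B8Prop6CubeMemberFlatScalar.prop6_cubeMember_flat_of_real` (letters `S = □₀`, `K` at `(η, L, n, cubeLamS, w)`), for every `v` supported in `□₀`:
`Σ_{j≤n} min{8, w_jη²L^{2j}L^{−dj}}·(Lʲη)⁻²·Σ_{x∈□₀ : B^j(x)∈Λs_n(j)} v(x)² ≤ Σ_{x,z∈□₀} v(x)K(x,z)v(z)`; the two geometric hypotheses of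
`weighted_coercive_flatDirichlet` are the cube member's `towerBlock_subset_cube` and `B8Eq191FlatLettersCubeMember.towers_disjoint_cube`.
[cite: Balaban1985RegularSpaces, (1.91) p.91, (1.131) p.99, (1.5)–(1.6) p.77; Balaban1984PropagatorsII, (2.26)–(2.27) p.235, p.228] -/
theorem weighted_coercive_cubeMember {η : ℝ} (hη : η ≠ 0) {L : ℕ} (hL : 1 ≤ L) (a : Fin d → ℤ) (M : ℕ) {ρ : ℕ} (hρ : L ≤ ρ)
    {k n : ℕ} (hn : n ≤ k) (w : ℕ → ℝ) (S : Finset (Fin d → ℤ)) (hS : ∀ x, x ∈ S ↔ x ∈ cubeFam false L a M ρ k 0)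
    (K : (Fin d → ℤ) → (Fin d → ℤ) → ℝ)
    (hK : ∀ x z, K x z = ((η ^ 2)⁻¹ * ∑ μ : Fin d, ((2 : ℝ) * (if z = x then (1 : ℝ) else 0) - (if z = x + e μ then (1 : ℝ) else 0)
        - (if z = x - e μ then (1 : ℝ) else 0))) +
        (∑ j ∈ Finset.range (n + 1), (if blockMap (L ^ j) x ∈ cubeLamS L a M ρ k n j ∧ blockMap (L ^ j) z = blockMap (L ^ j) x then
          w j * ((((L : ℝ) ^ d)⁻¹) ^ j) ^ 2 else 0)))
    (v : (Fin d → ℤ) → ℝ) (hv : ∀ x, x ∉ S → v x = 0) :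
    ∑ j ∈ Finset.range (n + 1), min 8 (w j * η ^ 2 * ((L : ℝ) ^ j) ^ 2 * (((L : ℝ) ^ d) ^ j)⁻¹) * (((L : ℝ) ^ j * η) ^ 2)⁻¹ *
        ∑ x ∈ S.filter (fun x => blockMap (L ^ j) x ∈ cubeLamS L a M ρ k n j), v x ^ 2
      ≤ ∑ x ∈ S, ∑ z ∈ S, v x * K x z * v z := by
  refine weighted_coercive_flatDirichlet hη hL n (cubeLamS L a M ρ k n) w K hK S v hv ?_ ?_
  · intro j hj x hx hxj z hz
    exact (hS z).mpr (towerBlock_subset_cube hL a M hρ hn hj hxj hz)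
  · intro x hx j hj j' hj' h1 h2
    exact (towers_disjoint_cube hL a M hρ hn j hj j' hj' _ h1 _ h2 x ((hS x).mp hx) rfl rfl).1

end Literature.MathematicalPhysics.QuantumFieldTheory.Balaban1983to89.B8Eq191FlatDirichletCoercive

end
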